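import Summits.CriticalPhenomena.CardyFormulaZ2.Theorems.CardyFlipRussoVoronoiHubFromSmirnovBlackRegionLocal

/-!
# Stub `crossEvent_iff_of_local` of line `moebius-exact-delaunay-dilation-ward`
# (crux `VoronoiHubFromSmirnov`, stmt-CriticalPhenomena-6433)

**Locality of the crux's crossing event.**  The crossing event `crossEvent R δ` at mesh `δ` reads
the nuclei `c = (black, white)` in configuration coordinates: the physical closed domain
`closure Ω = closure R.carrier` corresponds to `D := (· / δ) '' closure Ω`.  This file proves that
the event is LOCAL: once every point of `D` has a nucleus (black or white) within distance `< s`,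
membership of `c` in `crossEvent R δ` only depends on the nuclei of `c` inside the open
`2s`-thickening of `D` (Bollobás–Riordan, *Percolation* (CUP 2006), Ch. 8; the deterministic half of
every localisation / coupling argument of the line — conformal transport S3, domain Markov for S4).

Proof.  By the landed locality of the Voronoi colouring (`blackRegion_inter_eq_of_local`) the black
regions of `c` and `c'` agree on `D`; hence the two "black subsets of `closure Ω`"
`closure Ω ∩ {z | infDist (z/δ) c.1 ≤ infDist (z/δ) c.2}` (for `c` and for `c'`) are equal
(`cel_blackSet_eq`), and `crossEvent` membership is a predicate of that set.

No new definitions; Mathlib only.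
-/

noncomputable section

namespace Summit.CriticalPhenomena.CardyFormulaZ2.Cruxes.VoronoiHubFromSmirnov.MoebiusExactDelaunayDilationWard

open Set MeasureTheory Literature.Analysis.FunctionSpaces Literature.Probability.RandomPlanarGeometry

/-- The black subsets of a set `K` (read at mesh `δ`) of two nonempty nucleus pairs `(B, W)`,
`(B', W')` coincide, provided the pairs agree inside the open `2s`-thickening of `D := (· / δ) '' K`
and every point of `D` has a nucleus of `B ∪ W` within distance `< s`. -/
theorem cel_blackSet_eq (K B W B' W' : Set ℂ) (δ s : ℝ) (hB : B.Nonempty) (hW : W.Nonempty)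
    (hB' : B'.Nonempty) (hW' : W'.Nonempty)
    (hBB' : B ∩ Metric.thickening (2 * s) ((fun z : ℂ => z / (δ : ℂ)) '' K) =
      B' ∩ Metric.thickening (2 * s) ((fun z : ℂ => z / (δ : ℂ)) '' K))
    (hWW' : W ∩ Metric.thickening (2 * s) ((fun z : ℂ => z / (δ : ℂ)) '' K) =
      W' ∩ Metric.thickening (2 * s) ((fun z : ℂ => z / (δ : ℂ)) '' K))
    (hK : ∀ z ∈ K, Metric.infDist (z / (δ : ℂ)) (B ∪ W) < s) :
    K ∩ {z | Metric.infDist (z / (δ : ℂ)) B ≤ Metric.infDist (z / (δ : ℂ)) W} =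
      K ∩ {z | Metric.infDist (z / (δ : ℂ)) B' ≤ Metric.infDist (z / (δ : ℂ)) W'} := by
  have hD : ∀ z' ∈ (fun z : ℂ => z / (δ : ℂ)) '' K, Metric.infDist z' (B ∪ W) < s := by
    rintro _ ⟨z, hz, rfl⟩
    exact hK z hz
  have hBR := blackRegion_inter_eq_of_local B W B' W' _ s hB hW hB' hW' hBB' hWW' hD
  refine Set.ext fun z => and_congr_right fun hz => ?_
  have hzD : z / (δ : ℂ) ∈ (fun z : ℂ => z / (δ : ℂ)) '' K := Set.mem_image_of_mem _ hz
  have h := Set.ext_iff.1 hBR (z / (δ : ℂ))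
  simp only [Set.mem_inter_iff, Literature.Probability.Percolation.mem_blackRegion, hzD,
    and_true] at h
  exact h

/-- **Locality of the crossing event** (Bollobás–Riordan 2006, Ch. 8): if every point of
`D := (· / δ) '' closure Ω` has a nucleus of `c.1 ∪ c.2` within distance `< s` and the nonempty
nucleus pairs `c`, `c'` agree inside the open `2s`-thickening of `D`, then
`c ∈ crossEvent R δ ↔ c' ∈ crossEvent R δ`. -/
theorem crossEvent_iff_of_local : ∀ (R : ConformalRectangle) (δ s : ℝ) (c c' : PointConfig ℂ × PointConfig ℂ), 0 < δ → (c.1 : Set ℂ).Nonempty → (c.2 : Set ℂ).Nonempty → (c'.1 : Set ℂ).Nonempty → (c'.2 : Set ℂ).Nonempty → (c.1 : Set ℂ) ∩ Metric.thickening (2 * s) ((fun z : ℂ => z / (δ : ℂ)) '' closure R.carrier) = (c'.1 : Set ℂ) ∩ Metric.thickening (2 * s) ((fun z : ℂ => z / (δ : ℂ)) '' closure R.carrier) → (c.2 : Set ℂ) ∩ Metric.thickening (2 * s) ((fun z : ℂ => z / (δ : ℂ)) '' closure R.carrier) = (c'.2 : Set ℂ) ∩ Metric.thickening (2 * s) ((fun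 z : ℂ => z / (δ : ℂ)) '' closure R.carrier) → (∀ z ∈ closure R.carrier, Metric.infDist (z / (δ : ℂ)) ((c.1 : Set ℂ) ∪ (c.2 : Set ℂ)) < s) → (c ∈ crossEvent R δ ↔ c' ∈ crossEvent R δ) := by
  intro R δ s c c' _ h₁ h₂ h₁' h₂' hBB' hWW' hK
  have hS := cel_blackSet_eq (closure R.carrier) (c.1 : Set ℂ) (c.2 : Set ℂ) (c'.1 : Set ℂ)
    (c'.2 : Set ℂ) δ s h₁ h₂ h₁' h₂' hBB' hWW' hK
  simp only [crossEvent, Set.mem_setOf_eq]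
  rw [hS]

end Summit.CriticalPhenomena.CardyFormulaZ2.Cruxes.VoronoiHubFromSmirnov.MoebiusExactDelaunayDilationWard

end
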